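import Summits.Langlands.Langlands.Statement
import Summits.Langlands.Langlands.Theorems.IrreducibilityBySelfDualityVarmaWeilTracesUnramified
import Literature.NumberTheory.GaloisRepresentations.PowLocallyAlgebraicProofs
import Literature.NumberTheory.GaloisRepresentations.WeakAbelianDirectSummandCyclotomicProofs
import Literature.NumberTheory.GaloisRepresentations.WeilDeligneOfGaloisUnramifiedProofs
import Literature.NumberTheory.GaloisRepresentations.WeilGroupFrobeniusPowers
import Literature.NumberTheory.GaloisRepresentations.InertiaCharacter
import Literature.NumberTheory.GaloisRepresentations.LocalGaloisGroupFrobeniusProofs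
import Literature.NumberTheory.Automorphic.GLOneOfHeckeCharacterBJ
import Literature.NumberTheory.Automorphic.GLOneArchParameterOfAlgebraicCharacter
import Literature.NumberTheory.Automorphic.LocalLanglandsGLOne
import Literature.NumberTheory.Automorphic.HeckeCharacterLocalComponentSmooth
import Literature.NumberTheory.Automorphic.AutomorphicTwistSatake
import Literature.NumberTheory.Automorphic.WhittakerCoeffLocalDatum
import Literature.NumberTheory.Automorphic.ShintaniWhittakerFormula
import Literature.NumberTheory.Automorphic.AdicCompletionLocalField
import HarnessLib

/-!
# Line `Sketch` for the crux `ReciprocityUpToIrreducibility` (item stmt-Langlands-14328), wave N16-C: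
# rank one, the `E`-rational sector — automorphy AND the local–global clause at almost every place

Support file (closes nothing; `--supports stmt-Langlands-14328`; registered stub
`stub_rankOne_automorphy_ae_of_isRationalOver` of the checked skeleton of line `Sketch`, continuation
lead c10, wave N16).

Let `K` be ANY number field, `ℓ` a prime, `ι : ℚ̄_ℓ ≃+* ℂ`, `Rec` ANY reciprocity datum of `K`,
`E ⊂ ℚ̄_ℓ` a number field (`e : E →+* ℚ̄_ℓ`) and `ρ : Γ_K → GL₁(ℚ̄_ℓ)` an `E`-RATIONAL continuous
character (`FramedGaloisRep.IsRationalOver e`, Böckle–Hui §2.1).  Then there is a cuspidal,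
L-algebraic automorphic representation datum `π` of `GL₁(𝔸_K)` such that at ALL BUT FINITELY MANY
finite places `v` BOTH clauses of the summit's `Corresponds Rec ι π ρ` hold at `v`: Satake–Frobenius
compatibility `SatakeFrobCompatibleAt ι π ρ v` and local–global compatibility
`LocalGlobalCompatibleAt Rec ι π ρ v` (Summits/Langlands/Langlands/Statement.lean) — direction (B)
of reciprocity in rank one on the `E`-rational sector, up to finitely many places, with NO named
fact:

* (`rankOne_automorphy_ae_of_isRationalOver`) in rank one `ρ` is semisimple and weakly divides
  itself, so Böckle–Hui 2025, Thm. 1.1 in the Hecke-character form of BH §3.2.1 — PROVED in the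
  tree, `exists_heckeCharacter_of_weaklyDivides_holds` — gives an ALGEBRAIC Hecke character `θ`,
  unramified at almost every `v`, with `char ρ(Frob_v) = X - ι⁻¹(θ(ϖ_v))⁻¹` almost everywhere;
  `π = π_θ = ℂ·(θ ∘ det)/⊥` is the Borel–Jacquet datum (`exists_automorphicRepData_detTwist_glOne`),
  cuspidal (no proper parabolic), L-algebraic (infinity type `ι ↦ {(-n_ι, -n_ῑ)}` with integral
  exponents, `AutomorphicRepData.exists_hasInfinityType_of_hasInfinityType_heckeCharacter_glOne`),
  with Satake parameter `{θ(ϖ_v)}` off a level of `θ` (`hasSatakeParamAt_detTwist_glOne`);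
* (`localGlobalCompatibleAt_detTwist_glOne_away_aux`) at a place `v ∤ ℓ` where `θ` and `ρ` are
  unramified and `char ρ(Frob_v) = X - ι⁻¹(θ(ϖ_v))⁻¹`, the clause `LocalGlobalCompatibleAt` is
  witnessed EXPLICITLY: the local component `π_v = θ_v ∘ det` (Flath in rank one, on the line
  `ℂ·(θ ∘ det)`: `det ∘ ι_v = (det ·)_v`), the Weil–Deligne representation `r = (ρ|_{W_{K_v}}, 0)`
  (attached to `ρ|_{W_{K_v}}` by the Grothendieck–Deligne recipe since `ρ` kills `I_{K_v}`,
  `IsWeilDeligneOfLadic.of_N_eq_zero` with ANY character of inertia not identically `1`,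
  `WeilGroup.exists_inertiaCharacter_ne_one_top`), and `rℂ = (θ_v ∘ artin_v, 0)` on `ℂ¹`
  (`WeilDeligneRep.ofQuasiCharOn`), which IS `ι(r)`: both are unramified characters of `W_{K_v}`
  and for every `w` one has `ι(ρ(w)) = ι(ι⁻¹(θ(ϖ_v))⁻¹)^{deg w} = θ(ϖ_v)^{-deg w} = θ_v(artin_v w)`
  (Weil traces of an unramified representation, `trace_toLocal_eq_of_isUnramifiedAt_of_hasFrobCharpolyAt`;
  `Φ^{deg w} w ∈ I_{K_v}`, `artin_v(I) = 𝒪ˣ`, `artin_v Φ` a uniformiser); and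
  `rℂ ∈ rec_v(π_v)` because every local Langlands correspondence is local class field theory in
  degree one (`IsLocalLanglandsGL.rec_one_mk`).  Only finitely many places lie over `ℓ`
  (`FramedGaloisRep.eventually_natCast_not_mem`).

The residue toward the full (B)₁ is the finitely many bad places and Fontaine–Mazur rationality
(geometric ⇒ `E`-rational), both out of scope here.

References: G. Böckle, C.-Y. Hui, Math. Ann. 393 (2025), Thm. 1.1 and §3.2.1 [BockleHui2025];
A. Borel, H. Jacquet, Corvallis 1979, 4.6 [BorelJacquet1979]; K. Buzzard, T. Gee, LMS LNS 414
(2014), Def. 3.1.1, Conj. 3.2.1–3.2.2 [BuzzardGeeLMS2014]; J. Tate, Corvallis 1979, (1.4.1)–(4.2.1)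
[TateCorvallis1979]; M. Harris, R. Taylor (2001), Thm. A (i) [HarrisTaylorAMS2001]; D. Flath,
Corvallis 1979, Thm. 3 [FlathCorvallis1979].

No definitions; standard axioms only; no named fact.
-/

noncomputable section

set_option linter.dupNamespace false -- project-wide option (lakefile weak.linter.dupNamespace); `Summit.Langlands.Langlands` is the mandated namespace

open scoped NumberField Classical Polynomial MatrixGroups Matrix
open Filter IsDedekindDomain Field Polynomial
open Literature.NumberTheory.Automorphic Literature.NumberTheory.GaloisRepresentations
open Literature.NumberTheory.PAdicHodge
open Summit.Langlands
open Summit.Langlands.Langlands.Theorems.VarmaWeilTracesUnramified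

namespace Summit.Langlands.Langlands.Theorems.ReciprocityUpToIrreducibility

section RankOneRationalAway

variable {K : Type} [Field K] [NumberField K] {ℓ : ℕ} [Fact ℓ.Prime]

/-! ### 1. The Galois side at an unramified place, rank one -/

/-- The matrix of `ρ|_{W_F}(w)` (`FramedRep.weilRestrict`, `x ↦ ρ(w) *ᵥ x`) in the standard basis is
the matrix `ρ(w)`. [cite: TateCorvallis1979, (1.4.1)] -/
private theorem toMatrix'_weilRestrict_aux {F : Type} [Field F] [ValuativeRel F] [TopologicalSpace F]
    [IsNonarchimedeanLocalField F] {n : ℕ} (ρ : FramedRep (absoluteGaloisGroup F) (PadicAlgCl ℓ) n)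
    (w : WeilGroup F) :
    LinearMap.toMatrix' (ρ.weilRestrict F w) =
      ((ρ (WeilGroup.toAbsGalois F w) : GL (Fin n) (PadicAlgCl ℓ)) : Matrix (Fin n) (Fin n) (PadicAlgCl ℓ)) := by
  have h : ρ.weilRestrict F w = Matrix.toLin'
      ((ρ (WeilGroup.toAbsGalois F w) : GL (Fin n) (PadicAlgCl ℓ)) : Matrix (Fin n) (Fin n) (PadicAlgCl ℓ)) :=
    LinearMap.ext fun x => by rw [Matrix.toLin'_apply, FramedRep.weilRestrict_apply_apply]
  rw [h, LinearMap.toMatrix'_toLin']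

/-- **`(ρ|_{W_{K_v}}, 0)` is attached to `ρ|_{W_{K_v}}` by the Grothendieck–Deligne recipe when `ρ`
is unramified at `v`.**  Take `U = I_{K_v}` (open), a character `t : I_{K_v} →* ℚ̄_ℓ` not identically
`1` (`WeilGroup.exists_inertiaCharacter_ne_one_top`), a geometric Frobenius (`deg` is surjective)
and `N = 0` (`IsWeilDeligneOfLadic.of_N_eq_zero`); `ρ|_{W_{K_v}}` kills `I_{K_v}`
(`FramedGaloisRep.toWeilGroupHom_toLocal_eq_one_of_isUnramifiedAt`).
[cite: TateCorvallis1979, (4.1.3)–(4.2.1)] [cite: DeligneAntwerpII1973, §8.4.2] -/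
private theorem isWeilDeligneOfLadic_ofRep_toLocal_aux {n : ℕ} (ρ : FramedGaloisRep K (PadicAlgCl ℓ) n)
    {v : HeightOneSpectrum (𝓞 K)} (hρ : ρ.IsUnramifiedAt v)
    (h : WeilGroup.IsContinuousRep ((ρ.toLocal v).weilRestrict (v.adicCompletion K))) :
    IsWeilDeligneOfLadic (ρ.toLocal v).toWeilGroupHom
      (WeilDeligneRep.ofRep ((ρ.toLocal v).weilRestrict (v.adicCompletion K)) h) := by
  obtain ⟨t, u, htu⟩ :=
    WeilGroup.exists_inertiaCharacter_ne_one_top (F := v.adicCompletion K) (PadicAlgCl ℓ)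
  obtain ⟨Φ, hΦ⟩ := WeilGroup.deg_surjective IsFrobPow.mul_holds IsFrobPow.unique_holds
    (exists_isFrobPow_holds (v.adicCompletion K)) (-1 : ℤ)
  refine IsWeilDeligneOfLadic.of_N_eq_zero _ _ (WeilDeligneRep.ofRep_N _ _) t
    (WeilGroup.inertia (v.adicCompletion K)) le_rfl (WeilGroup.isOpen_inertia _) ⟨u, u.2, htu⟩
    (ρ.toWeilGroupHom_toLocal_eq_one_of_isUnramifiedAt hρ) Φ hΦ fun m w => ?_
  rw [WeilDeligneRep.ofRep_ρ, toMatrix'_weilRestrict_aux, FramedRep.toWeilGroupHom_apply]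

/-- **The transport of `(ρ|_{W_{K_v}}, 0)` along `ι` is `(χ_v ∘ artin_v, 0)`, rank one.**  Let
`ρ : Γ_K → GL₁(ℚ̄_ℓ)` be unramified at `v` with `char ρ(Frob_v^{arith}) = X - ι⁻¹(χ_v(ϖ))⁻¹` for a
quasi-character `χ_v` of `K_vˣ` trivial on `𝒪_vˣ` and a uniformiser `ϖ`, and let `L` be any local
Langlands datum of `K_v`.  Then `(χ_v ∘ artin_L, 0)` on `ℂ¹` (`WeilDeligneRep.ofQuasiCharOn`) is a
transport of `(ρ|_{W_{K_v}}, 0)` along `ι`: for every `w ∈ W_{K_v}`,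
`ι(tr ρ(w)) = ι(ι⁻¹(χ_v(ϖ))⁻¹)^{deg w} = χ_v(ϖ)^{-deg w}` (Weil traces of an unramified representation,
`trace_toLocal_eq_of_isUnramifiedAt_of_hasFrobCharpolyAt`), while `χ_v(artin w) = χ_v(artin Φ)^{-deg w}`
for a geometric Frobenius `Φ` (`Φ^{deg w} w ∈ I`, `artin(I) = 𝒪ˣ`) and `χ_v(artin Φ) = χ_v(ϖ)`
(`artin Φ` is a uniformiser). [cite: TateCorvallis1979, (1.4.1)–(1.4.6) and (4.2.1)]
[cite: DeligneAntwerpII1973, §8.4.3] -/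
private theorem isTransportAlong_ofQuasiCharOn_aux (ι : PadicAlgCl ℓ ≃+* ℂ)
    (ρ : FramedGaloisRep K (PadicAlgCl ℓ) 1) {v : HeightOneSpectrum (𝓞 K)} (hρ : ρ.IsUnramifiedAt v)
    (h : WeilGroup.IsContinuousRep ((ρ.toLocal v).weilRestrict (v.adicCompletion K)))
    (L : LocalLanglandsDatum (v.adicCompletion K)) (χv : QuasiChar (v.adicCompletion K))
    (hχv1 : ∀ u : (v.adicCompletion K)ˣ,
      u ∈ (ValuativeRel.valuation (v.adicCompletion K)).valuationSubring.unitGroup → χv u = 1)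
    {ϖ : (v.adicCompletion K)ˣ} (hϖ : Valued.v (ϖ : v.adicCompletion K) = WithZero.exp (-1 : ℤ))
    (hfrob : ρ.HasFrobCharpolyAt v (X - C (ι.symm ((χv ϖ : ℂˣ) : ℂ)⁻¹))) :
    (WeilDeligneRep.ofRep ((ρ.toLocal v).weilRestrict (v.adicCompletion K)) h).IsTransportAlong
      (ι : PadicAlgCl ℓ →+* ℂ) (WeilDeligneRep.ofQuasiCharOn (Fin 1 → ℂ) L.hns L.artin χv) := by
  set a : ℂ := ((χv ϖ : ℂˣ) : ℂ)
  obtain ⟨Φ, hΦ⟩ := WeilGroup.deg_surjective IsFrobPow.mul_holds IsFrobPow.unique_holds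
    (exists_isFrobPow_holds (v.adicCompletion K)) (-1 : ℤ)
  -- `χ_v(artin Φ) = χ_v(ϖ)`: both `artin Φ` and `ϖ` are uniformisers, `χ_v` kills `𝒪_vˣ`
  have hunit : L.artin.artin Φ * ϖ⁻¹ ∈
      (ValuativeRel.valuation (v.adicCompletion K)).valuationSubring.unitGroup := by
    have hval : ValuativeRel.valuation (v.adicCompletion K) (ϖ : v.adicCompletion K) =
        ValuativeRel.valuation (v.adicCompletion K) (L.artin.artin Φ : v.adicCompletion K) :=
      (isUniformizingElement_of_valued_eq K v hϖ).valuation_eq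
        (isUniformizingElement_of_isUniformizer (L.artin.artin_frob Φ hΦ))
    have h0 : ValuativeRel.valuation (v.adicCompletion K) (ϖ : v.adicCompletion K) ≠ 0 :=
      (Valuation.ne_zero_iff _).mpr ϖ.ne_zero
    rw [Valuation.mem_unitGroup_iff, Units.val_mul, Units.val_inv_eq_inv_val, map_mul, map_inv₀,
      ← hval, mul_inv_cancel₀ h0]
  have hΦa : χv (L.artin.artin Φ) = χv ϖ := by
    have : L.artin.artin Φ = (L.artin.artin Φ * ϖ⁻¹) * ϖ := by group
    rw [this, map_mul, hχv1 _ hunit, one_mul]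
  -- `χ_v(artin w) = χ_v(ϖ) ^ (-deg w)` for every `w`
  have hχw : ∀ w : WeilGroup (v.adicCompletion K),
      ((χv (L.artin.artin w) : ℂˣ) : ℂ) = a ^ (-WeilGroup.deg w) := fun w => by
    have hu : L.artin.artin (Φ ^ WeilGroup.deg w * w) ∈
        (ValuativeRel.valuation (v.adicCompletion K)).valuationSubring.unitGroup := by
      rw [← L.artin.image_inertia]
      exact Subgroup.mem_map_of_mem _ (WeilGroup.zpow_deg_mul_mem_inertia hΦ w)
    have h1 := hχv1 _ hu
    rw [map_mul, map_mul, map_zpow, map_zpow, hΦa] at h1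
    rw [eq_inv_of_mul_eq_one_right h1, ← zpow_neg, Units.val_zpow_eq_zpow_val]
  -- the (only) entry of `ρ(w)` is `(ι⁻¹ a⁻¹) ^ (deg w)` for every `w` (Weil traces, unramified case)
  have htr : ∀ w : WeilGroup (v.adicCompletion K),
      (((ρ.toLocal v) (WeilGroup.toAbsGalois (v.adicCompletion K) w) : GL (Fin 1) (PadicAlgCl ℓ)) :
        Matrix (Fin 1) (Fin 1) (PadicAlgCl ℓ)) 0 0 = (ι.symm a⁻¹) ^ WeilGroup.deg w := fun w => by
    have hfrob' : ρ.HasFrobCharpolyAt v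
        ((({ι.symm a⁻¹} : Multiset (PadicAlgCl ℓ)).map fun b => X - C b).prod) := by
      simpa using hfrob
    have ht := trace_toLocal_eq_of_isUnramifiedAt_of_hasFrobCharpolyAt v ρ {ι.symm a⁻¹} hρ hfrob'
      (WeilGroup.toAbsGalois (v.adicCompletion K) w) (WeilGroup.deg w)
      (WeilGroup.isFrobPow_deg IsFrobPow.mul_holds w)
    rw [Matrix.trace_fin_one] at ht
    simpa using ht
  refine ⟨fun w => ?_, ?_⟩
  · ext i j
    obtain rfl : i = 0 := Subsingleton.elim _ _
    obtain rfl : j = 0 := Subsingleton.elim _ _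
    rw [Matrix.map_apply, WeilDeligneRep.ofRep_ρ, toMatrix'_weilRestrict_aux, htr w, map_zpow₀,
      RingEquiv.coe_toRingHom, RingEquiv.apply_symm_apply, inv_zpow', LinearMap.toMatrix'_apply,
      WeilDeligneRep.ofQuasiCharOn_ρ_apply, Pi.smul_apply, smul_eq_mul, hχw w]
    simp
  · rw [WeilDeligneRep.ofQuasiCharOn_N, WeilDeligneRep.ofRep_N, map_zero, map_zero, Matrix.map_zero]
    exact map_zero _

/-! ### 2. The automorphic side: the Borel–Jacquet datum `π_θ = ℂ·(θ ∘ det)/⊥` -/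

/-- **The local component of `π_θ = ℂ·(θ ∘ det)/⊥` at `v` is `χ_v ∘ det`** for any quasi-character
`χ_v` of `K_vˣ` agreeing with `θ_v = θ ∘ (K_vˣ ↪ 𝕀_K)` (Flath in rank one, explicit): the line
`c ↦ c · (θ ∘ det)` is a non-zero `GL₁(K_v)`-equivariant map `ℂ → W/⊥`, because
`R(ι_v g)(θ ∘ det) = θ(det ι_v g) · (θ ∘ det)` (`rightTranslation_detTwist_glOne`) and
`det (ι_v g) = (det g)_v` (`GLn.det_ofLocal`). [cite: FlathCorvallis1979, Thm. 3]
[cite: BorelJacquet1979, 4.6] -/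
private theorem hasLocalComponentAt_detTwist_glOne_aux {hcpt : isCompact_glFiniteIntegralLevel 1 K}
    {θ : HeckeCharacter K} {τ : AutomorphicRepData (AutomorphyDatum.gl 1 K hcpt)}
    (hW : τ.W = Submodule.span ℂ {fun g : (AdelicGroupData.gl 1 K).Adelic => (detTwist 1 θ g : ℂ)})
    (hW' : τ.W' = ⊥) (v : HeightOneSpectrum (𝓞 K)) (χv : QuasiChar (v.adicCompletion K))
    (hχv : ∀ u : (v.adicCompletion K)ˣ, χv u = θ.localComponent v u) :
    τ.HasLocalComponentAt v (SmoothIrrep.ofQuasiChar χv).ρ := by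
  show τ.HasLocalComponentAt v (V := ℂ) (glOneRep (χv : (v.adicCompletion K)ˣ →* ℂˣ))
  refine ⟨LinearMap.toSpanSingleton ℂ ((AdelicGroupData.gl 1 K).Adelic → ℂ)
      (fun g : (AdelicGroupData.gl 1 K).Adelic => (detTwist 1 θ g : ℂ)), ?_, ?_, fun g x => ?_⟩
  · rw [LinearMap.range_toSpanSingleton, hW]
  · rw [LinearMap.range_toSpanSingleton, hW', le_bot_iff, Submodule.span_singleton_eq_bot]
    intro h0
    have h1 := congrFun h0 1
    rw [map_one, Units.val_one, Pi.zero_apply] at h1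
    exact one_ne_zero h1
  · rw [hW', Submodule.mem_bot, LinearMap.toSpanSingleton_apply, LinearMap.toSpanSingleton_apply,
      glOneRep_apply, map_smul, rightTranslation_detTwist_glOne, detTwist_apply', GLn.det_ofLocal,
      ← HeckeCharacter.localComponent_apply, ← hχv, smul_smul, mul_comm]
    exact sub_self _

/-- **`π_θ` is L-algebraic for `θ` algebraic.**  An algebraic Hecke character has an infinity type
`(p, q)` (`HeckeCharacter.isAlgebraic_iff_exists_hasInfinityType`); an automorphic representation
datum of `GL₁(𝔸_K)` on which `GL₁(𝔸_K)` acts through `θ ∘ det` then has the infinity type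
`ι ↦ {(-n_ι, -n_ῑ)}` (`AutomorphicRepData.exists_hasInfinityType_of_hasInfinityType_heckeCharacter_glOne`),
whose exponents are integers (`a = -n_ι ∈ ℤ`, `a - b ∈ ℤ`). [cite: BuzzardGeeLMS2014, Def. 3.1.1]
[cite: Clozel1990, §1.1 and §3.3 (n = 1)] -/
private theorem isLAlgebraic_glOne_of_isAlgebraic_aux {hcpt : isCompact_glFiniteIntegralLevel 1 K}
    {θ : HeckeCharacter K} (hθ : θ.IsAlgebraic) (τ : AutomorphicRepData (AutomorphyDatum.gl 1 K hcpt))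
    (hact : ∀ (g : (AdelicGroupData.gl 1 K).Adelic), ∀ φ ∈ τ.W,
      rightTranslation (AdelicGroupData.gl 1 K) g φ -
        ((θ (Matrix.GeneralLinearGroup.det g) : ℂˣ) : ℂ) • φ ∈ τ.W') :
    τ.IsLAlgebraic := by
  classical
  obtain ⟨p, q, hpq⟩ := (θ.isAlgebraic_iff_exists_hasInfinityType).mp hθ
  obtain ⟨T, hT, hTa⟩ := τ.exists_hasInfinityType_of_hasInfinityType_heckeCharacter_glOne hact hpq
  refine ⟨T, hT, fun σ w hw => ?_⟩
  have hwa : w.a = -((HeckeCharacter.embExponent p q σ : ℤ) : ℂ) := by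
    have hmem : w.a ∈ (T σ).map ArchWeight.a := Multiset.mem_map_of_mem _ hw
    rw [hTa σ] at hmem
    exact Multiset.mem_singleton.mp hmem
  obtain ⟨m, hm⟩ := w.exists_int_sub
  refine ⟨-HeckeCharacter.embExponent p q σ, -HeckeCharacter.embExponent p q σ - m, ?_, ?_⟩
  · rw [hwa]
    push_cast
    ring
  · have hb : w.b = w.a - m := by rw [← hm]; ring
    rw [hb, hwa]
    push_cast
    ring

/-! ### 3. Local–global compatibility of `(π_θ, ρ)` at the good places away from `ℓ` -/

/-- **Rank one, `v ∤ ℓ`: local–global compatibility of `(π_θ, ρ)` at a place where `θ` and `ρ` are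
unramified and `char ρ(Frob_v) = X - ι⁻¹(θ(ϖ_v))⁻¹`, for EVERY reciprocity datum.**  Witnesses: the
local component `π_v = θ_v ∘ det` (`θ_v` continuous, `HeckeCharacter.continuous_localComponent`,
trivial on `𝒪_vˣ` since the two unit groups of `K_v` agree,
`HeckeCharacter.exists_units_map_subtype_eq_of_valuation_eq_one`), `r = (ρ|_{W_{K_v}}, 0)`
(`isWeilDeligneOfLadic_ofRep_toLocal_aux`; the `v ∣ ℓ` clause is vacuous), its transport
`rℂ = (θ_v ∘ artin_v, 0)` (`isTransportAlong_ofQuasiCharOn_aux`), of class `rec_v(π_v)` since every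
local Langlands correspondence is local class field theory in degree one
(`IsLocalLanglandsGL.rec_one_mk`). [cite: BuzzardGeeLMS2014, Conj. 3.2.2 (n = 1)]
[cite: HarrisTaylorAMS2001, Thm. A (i)] [cite: TateCorvallis1979, (4.2.1)] -/
private theorem localGlobalCompatibleAt_detTwist_glOne_away_aux
    {hcpt : isCompact_glFiniteIntegralLevel 1 K} (Rec : ReciprocityData K) (ι : PadicAlgCl ℓ ≃+* ℂ)
    {θ : HeckeCharacter K} {τ : AutomorphicRepData (AutomorphyDatum.gl 1 K hcpt)}
    (hW : τ.W = Submodule.span ℂ {fun g : (AdelicGroupData.gl 1 K).Adelic => (detTwist 1 θ g : ℂ)})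
    (hW' : τ.W' = ⊥) (ρ : FramedGaloisRep K (PadicAlgCl ℓ) 1) {v : HeightOneSpectrum (𝓞 K)}
    (hv : ((ℓ : ℕ) : 𝓞 K) ∉ v.asIdeal) (hur : θ.IsUnramifiedAt v) (hρ : ρ.IsUnramifiedAt v)
    (hfrob : ρ.HasFrobCharpolyAt v (X - C (ι.symm (θ.valueAtUniformizer v)⁻¹))) :
    LocalGlobalCompatibleAt Rec ι τ ρ v := by
  -- the local component `θ_v` of `θ`: a quasi-character of `K_vˣ` killing `𝒪_vˣ`
  let χv : QuasiChar (v.adicCompletion K) :=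
    ContinuousMonoidHom.mk (θ.localComponent v) (θ.continuous_localComponent v)
  have hχv : ∀ u : (v.adicCompletion K)ˣ, χv u = θ.localComponent v u := fun _ => rfl
  have hχv1 : ∀ u : (v.adicCompletion K)ˣ,
      u ∈ (ValuativeRel.valuation (v.adicCompletion K)).valuationSubring.unitGroup → χv u = 1 := by
    intro u hu
    rw [Valuation.mem_unitGroup_iff] at hu
    obtain ⟨u₀, rfl⟩ := HeckeCharacter.exists_units_map_subtype_eq_of_valuation_eq_one v hu
    exact hur u₀
  have hlu : (ρ.toLocal v).IsLocallyUnramified := fun σ hσ => ρ.toLocal_eq_one_of_mem_absInertia hρ hσ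
  have hcont := hlu.isUnramifiedRep_weilRestrict.isContinuousRep
  refine ⟨SmoothIrrep.ofQuasiChar χv, WeilDeligneRep.ofRep _ hcont,
    WeilDeligneRep.ofQuasiCharOn (Fin 1 → ℂ) (Rec.llc v).hns (Rec.llc v).artin χv,
    hasLocalComponentAt_detTwist_glOne_aux hW hW' v χv hχv,
    fun _ => isWeilDeligneOfLadic_ofRep_toLocal_aux ρ hρ hcont, fun h' => absurd h' hv,
    isTransportAlong_ofQuasiCharOn_aux ι ρ hρ hcont (Rec.llc v) χv hχv1
      (HeckeCharacter.valued_uniformizer (K := K) v) hfrob, ?_⟩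
  rw [(Rec.llc v).isLocalLanglands.rec_one_mk (SmoothIrrep.ofQuasiChar_ρ_apply χv)]
  exact (WeilDeligneRep.isFrobSemisimple_ofQuasiCharOn _ _ χv).hasFrobSemisimpleClass

/-! ### 4. Assembly -/

/-- **Direction (B) in rank one on the `E`-rational sector, at almost every place, for EVERY `Rec`.**
For `ρ : Γ_K → GL₁(ℚ̄_ℓ)` `E`-rational and `ι : ℚ̄_ℓ ≃+* ℂ` there is a cuspidal, L-algebraic `π` of
`GL₁(𝔸_K)` with `SatakeFrobCompatibleAt ι π ρ v ∧ LocalGlobalCompatibleAt Rec ι π ρ v` at all but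
finitely many `v`: `ρ` is semisimple (`FramedGaloisRep.isSemisimple_toGaloisRep_of_rank_one`) and
weakly divides itself (`FramedGaloisRep.weaklyDivides_self_of_eventually_isUnramifiedAt`), so
Böckle–Hui (`exists_heckeCharacter_of_weaklyDivides_holds`, PROVED in the tree) gives an algebraic
`θ` with, a.e., `θ` and `ρ` unramified and `char ρ(Frob_v) = X - ι⁻¹(θ(ϖ_v))⁻¹`; `π = π_θ` is the
Borel–Jacquet datum (`exists_automorphicRepData_detTwist_glOne`; cuspidal, L-algebraic by
`isLAlgebraic_glOne_of_isAlgebraic_aux`, Satake parameter `{θ(ϖ_v)}` off a level of `θ`,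
`hasSatakeParamAt_detTwist_glOne`, and `arithFrobPolyOfSatake ι q_v 1 {θ(ϖ_v)} = X - ι⁻¹(θ(ϖ_v))⁻¹`);
the local–global clause at the remaining places away from `ℓ` is
`localGlobalCompatibleAt_detTwist_glOne_away_aux`, and only finitely many places lie over `ℓ`.
[cite: BockleHui2025, Theorem 1.1 and §3.2.1] [cite: BorelJacquet1979, 4.6]
[cite: BuzzardGeeLMS2014, Conj. 3.2.1–3.2.2 (n = 1)] [cite: FontaineMazurGeometric1995, Conj. 1 (n = 1)] -/
theorem rankOne_automorphy_ae_of_isRationalOver (hcpt : isCompact_glFiniteIntegralLevel 1 K)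
    (Rec : ReciprocityData K) (ι : PadicAlgCl ℓ ≃+* ℂ) {E : Type} [Field E] [NumberField E]
    (e : E →+* PadicAlgCl ℓ) (ρ : FramedGaloisRep K (PadicAlgCl ℓ) 1) (hrat : ρ.IsRationalOver e) :
    ∃ π : CuspidalAutomorphicRepData 1 K hcpt, π.1.IsLAlgebraic ∧
      ∀ᶠ v : HeightOneSpectrum (𝓞 K) in cofinite,
        SatakeFrobCompatibleAt ι π.1 ρ v ∧ LocalGlobalCompatibleAt Rec ι π.1 ρ v := by
  -- Böckle–Hui, Thm. 1.1 (Hecke-character form): the algebraic Hecke character `θ` of `ρ`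
  have hss : ρ.toGaloisRep.IsSemisimple := FramedGaloisRep.isSemisimple_toGaloisRep_of_rank_one ρ
  have hwd : ρ.WeaklyDivides ρ :=
    FramedGaloisRep.weaklyDivides_self_of_eventually_isUnramifiedAt hrat.eventually_isUnramifiedAt
  obtain ⟨θ, hθalg, hθ⟩ :=
    exists_heckeCharacter_of_weaklyDivides_holds K ℓ 1 E e ρ hss hrat ρ hwd ι
  -- the Borel–Jacquet datum `π_θ = ℂ·(θ ∘ det)/⊥`: cuspidal, Hecke character `θ`, L-algebraic
  obtain ⟨τ, hW, hW'⟩ := exists_automorphicRepData_detTwist_glOne hcpt θ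
  have hcusp : τ.W ≤ cuspFormsGL 1 K hcpt := by
    rw [hW, Submodule.span_le]
    rintro _ rfl
    exact IsCuspFormGL.mem_cuspFormsGL
      ⟨isAutomorphicForm_detTwist_glOne hcpt θ, fun k hk hk1 => absurd hk1 (by omega)⟩
  have hact : ∀ (g : (AdelicGroupData.gl 1 K).Adelic), ∀ φ ∈ τ.W,
      rightTranslation (AdelicGroupData.gl 1 K) g φ -
        ((θ (Matrix.GeneralLinearGroup.det g) : ℂˣ) : ℂ) • φ ∈ τ.W' := by
    intro g φ hφ
    rw [hW, Submodule.mem_span_singleton] at hφ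
    obtain ⟨c, rfl⟩ := hφ
    rw [map_smul, rightTranslation_detTwist_glOne, detTwist_apply', smul_comm, sub_self]
    exact τ.W'.zero_mem
  obtain ⟨𝔪, h𝔪, hθ𝔪⟩ := HeckeCharacter.exists_level_glOne θ
  refine ⟨⟨τ, hcusp⟩, isLAlgebraic_glOne_of_isAlgebraic_aux hθalg τ hact, ?_⟩
  filter_upwards [hθ, (Ideal.finite_factors h𝔪).compl_mem_cofinite,
    FramedGaloisRep.eventually_natCast_not_mem K ℓ] with v hv hv𝔪 hvℓ
  -- the Satake parameter `{θ(ϖ_v)}` of `π_θ` at `v`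
  have hsat : τ.HasSatakeParamAt v {θ.valueAtUniformizer v} := by
    have hs := AutomorphicRepData.hasSatakeParamAt_detTwist_glOne hcpt hW hW' h𝔪 hθ𝔪 v hv𝔪
      (HeckeCharacter.valued_uniformizer (K := K) v)
    simpa only [HeckeCharacter.valueAtUniformizer, HeckeCharacter.localComponent_apply] using hs
  refine ⟨⟨{θ.valueAtUniformizer v}, hsat, hv.2.1, ?_⟩,
    localGlobalCompatibleAt_detTwist_glOne_away_aux Rec ι hW hW' ρ hvℓ hv.1 hv.2.1 hv.2.2⟩
  rw [arithFrobPolyOfSatake_one, Multiset.map_singleton, Multiset.prod_singleton]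
  exact hv.2.2

end RankOneRationalAway

/-- **Registered stub `stub_rankOne_automorphy_ae_of_isRationalOver` of line `Sketch` (crux
stmt-Langlands-14328, wave N16-C), closed form of `rankOne_automorphy_ae_of_isRationalOver`** (all
binders explicit, in the order `K, ℓ, hcpt, Rec, ι, E, e, ρ`): over EVERY number field, for EVERY
reciprocity datum, every `E`-rational `ρ : Γ_K → GL₁(ℚ̄_ℓ)` corresponds at all but finitely many
places — Satake–Frobenius compatibility AND the summit's local–global clause — to a cuspidal
L-algebraic `π` of `GL₁(𝔸_K)` (the Borel–Jacquet datum of the algebraic Hecke character of `ρ`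
given by Böckle–Hui, Thm. 1.1). [cite: BockleHui2025, Theorem 1.1 and §3.2.1]
[cite: BuzzardGeeLMS2014, Conj. 3.2.1–3.2.2 (n = 1)] [cite: HarrisTaylorAMS2001, Thm. A (i)] -/
theorem stub_rankOne_automorphy_ae_of_isRationalOver :
    ∀ (K : Type) [Field K] [NumberField K] (ℓ : ℕ) [Fact ℓ.Prime] (hcpt : isCompact_glFiniteIntegralLevel 1 K)
      (Rec : ReciprocityData K) (ι : PadicAlgCl ℓ ≃+* ℂ) (E : Type) [Field E] [NumberField E]
      (e : E →+* PadicAlgCl ℓ) (ρ : FramedGaloisRep K (PadicAlgCl ℓ) 1), ρ.IsRationalOver e →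
      ∃ π : CuspidalAutomorphicRepData 1 K hcpt, π.1.IsLAlgebraic ∧
        ∀ᶠ v : HeightOneSpectrum (𝓞 K) in cofinite,
          SatakeFrobCompatibleAt ι π.1 ρ v ∧ LocalGlobalCompatibleAt Rec ι π.1 ρ v :=
  fun _ _ _ _ _ hcpt Rec ι _ _ _ e ρ hrat => rankOne_automorphy_ae_of_isRationalOver hcpt Rec ι e ρ hrat

end Summit.Langlands.Langlands.Theorems.ReciprocityUpToIrreducibility

end
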